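import Literature.AnabelianGeometry.EtaleTheta.LogDivisorModelGaloisAction
import HarnessLib

/-!
# [EtTh] Def 3.1 / Prop 3.2: a NON-DEGENERATE inhabitant of the interface `LogDivisorModel` — the universal
# combinatorial covering of a curve with SMOOTH reduction (one special-fibre component, no cusps)

S. Mochizuki, *The étale theta function and its Frobenioid-theoretic manifestations*, Publ. RIMS **45** (2009)
[MochizukiEtTh2009], §3, Def. 3.1 (i)(ii) and Prop. 3.2 (i)–(iii), PDF p. 70 (printed p. 296): log-divisors are the
divisors supported in "the union of the special fiber and divisor of cusps"; "`Div⁺ ⊆ DIV⁺ ⊆ DIV`"; a log-meromorphic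
function is "a nonzero meromorphic function whose divisor of zeroes and poles is a log-divisor"; "a log-meromorphic
function arising from `L^×` will be referred to as constant"; Prop. 3.2 (ii) "all regular functions on `Z_∞` are
constant"; (iii) an infinitely divisible nonzero meromorphic function is `1` [cite: MochizukiEtTh2009, Def 3.1 p.70]
[cite: MochizukiEtTh2009, Prop 3.2 p.70].

abc-iut cell, block C / W6, seat abc-iut-w6-d048 (gen 3).  CLASS (b) MODEL / NON-VACUITY construction (one new
inhabitant of the FROZEN interface `LogDivisorModel` of abc-iut-L2-t3's `TemperedCoverings.lean`; nothing frozen is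
edited).  WHY: the tree's only inhabitant so far is the DEGENERATE `LogDivisorModel.toy` (`Fn = DIV = 1`, no cusps, no
components), over which abc-iut-w6-d058's constructed Def. 3.3 (iii) data `DivisorMonoids.ofGaloisAction(Connected)` have
TRIVIAL `Φ₀`, so that NO tempered Frobenioid (Def. 3.6 (ii)(b): "`F(A) → (Φ^{bs-fld})^gp(A)` is nonzero") exists over
them — every theorem "for every tempered Frobenioid over the constructed connected data" (abc-iut-w5-d179's Thm. 4.4 /
Def. 3.6 (ii) / Thm. 3.7 files, this seat's `Λ = ℝ` files) is vacuous in the tree (cell finding F-w6d048g3-1).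

THE MODEL `LogDivisorModel.oneComp U hU`.  Geometry: `X^log` a PROPER hyperbolic curve (no cusps) with SMOOTH reduction
over `O_K`; its stable model has one irreducible component `F` and no nodes, so the universal combinatorial covering is
`Z_∞ = X` itself (`Gal(Z^log_∞/X^log) = 1`).  Then, reading Def. 3.1 / Prop. 3.2 on the page:
* `DIV = ℤ·[F]` (`:= Multiplicative ℤ`), `DIV⁺ = ℤ_{≥0}·[F]`, every log-divisor is Cartier (`[F] = div(ϖ)`): `Div = ⊤`;
  `Cusp = ∅`, `Comp = {F}`; non-cuspidal = everything, cuspidal = `0`;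
* a log-meromorphic function has vertical divisor `n·[F] = div(ϖⁿ)`, so `f/ϖⁿ ∈ Γ(Z_∞, O^×) = O_L^×` by Prop. 3.2 (ii):
  EVERY log-meromorphic function is constant, `Mero(Z_∞) = L^× = O_L^× · ϖ^ℤ`; the model records exactly this group:
  `Fn := U × Multiplicative ℤ` (`U` = the unit group `O_L^×`, a parameter), `logMero = const = ⊤`, `divisor = ` the
  valuation (second projection), `intConst = O_L^▷ = {v ≥ 0}`;
* Prop. 3.2 (i): `n = 1`; (ii): "effective divisor ⇒ integral constant" holds by construction; (iii): an infinitely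
  divisible element of `U × ℤ` is trivial as soon as `U` has no non-trivial infinitely divisible element (`hU`; true for
  `O_L^×` of a `p`-adic field, and trivially for `U = 1`).
Also: `cuspLaws_oneComp` (abc-iut-w6-d058's tacit Def. 3.1 (i) compatibilities `CuspLaws` hold), the unconditional
instance `oneComp₁ := oneComp PUnit` (value-group shadow `L^×/O_L^×`), simp lemmas.
HONEST LABEL: DEGENERATE BUT GENUINE geometry (smooth reduction: one component, no cusps, all log-meromorphic functions
constant) — an instance of Def. 3.1's setting, NOT the Tate curve / not a curve with cusps; `Fn` records `Mero(Z_∞) = L^×`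
only (the interface reads `Fn` through `logMero ⊆ Fn`).  Nothing here bears on [IUTchIII] Cor. 3.12; no side taken.
-/

namespace Literature.AnabelianGeometry.EtaleTheta

namespace LogDivisorModel

/-! ### The value group `ℤ·[F]` and its effective part -/

/-- `DIV⁺ = ℤ_{≥0}·[F] ⊆ ℤ·[F]`: the effective log-divisors of the one-component model, as a submonoid of
`Multiplicative ℤ`. [cite: MochizukiEtTh2009, Def 3.1 p.70] -/
def OneComp.nonneg : Submonoid (Multiplicative ℤ) where
  carrier := {d | 0 ≤ Multiplicative.toAdd d}
  mul_mem' {a b} ha hb := by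
    change 0 ≤ Multiplicative.toAdd (a * b)
    rw [toAdd_mul]
    exact add_nonneg ha hb
  one_mem' := le_refl (0 : ℤ)

/-- Membership in `ℤ_{≥0}·[F]`. [cite: MochizukiEtTh2009, Def 3.1 p.70] -/
@[simp] theorem OneComp.mem_nonneg_iff (d : Multiplicative ℤ) : d ∈ OneComp.nonneg ↔ 0 ≤ Multiplicative.toAdd d :=
  Iff.rfl

/-- The valuation coordinate `n` of the log-divisor `n·[F]` (a copy of `Multiplicative.toAdd` with FIXED carrier
`Multiplicative ℤ`, so that it applies verbatim to the field `DIV` of the model below). [cite: MochizukiEtTh2009, Def 3.1 p.70] -/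
def OneComp.val (d : Multiplicative ℤ) : ℤ := Multiplicative.toAdd d

/-- `val (ofAdd n) = n`. [cite: MochizukiEtTh2009, Def 3.1 p.70] -/
@[simp] theorem OneComp.val_ofAdd (n : ℤ) : OneComp.val (Multiplicative.ofAdd n) = n := rfl

/-- `val 1 = 0`. [cite: MochizukiEtTh2009, Def 3.1 p.70] -/
@[simp] theorem OneComp.val_one : OneComp.val 1 = 0 := rfl

/-- `val d = 0 ↔ d = 1`. [cite: MochizukiEtTh2009, Def 3.1 p.70] -/
theorem OneComp.val_eq_zero_iff (d : Multiplicative ℤ) : OneComp.val d = 0 ↔ d = 1 := toAdd_eq_zero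

/-- Def. 3.1 (i) for the one-component model: `DIV⁺ = ℤ_{≥0}·[F] ≅ ℕ^{∅ ⊔ {F}}` (multiplicity along `F`).
[cite: MochizukiEtTh2009, Def 3.1 p.70] -/
def OneComp.divPlusEquiv : OneComp.nonneg ≃* (PEmpty.{1} ⊕ PUnit.{1} → Multiplicative ℕ) where
  toFun d := fun _ => Multiplicative.ofAdd (Multiplicative.toAdd d.1).toNat
  invFun f := ⟨Multiplicative.ofAdd ((Multiplicative.toAdd (f (Sum.inr PUnit.unit)) : ℕ) : ℤ),
    by simp only [mem_nonneg_iff, toAdd_ofAdd]; exact Int.natCast_nonneg _⟩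
  left_inv d := by
    apply Subtype.ext
    simp only [toAdd_ofAdd, Int.toNat_of_nonneg d.2, ofAdd_toAdd]
  right_inv f := by
    funext x
    rcases x with e | u
    · exact e.elim
    · simp only [toAdd_ofAdd, Int.toNat_natCast, ofAdd_toAdd]
  map_mul' d d' := by
    funext x
    simp only [Submonoid.coe_mul, toAdd_mul, Pi.mul_apply, ← ofAdd_add, Int.toNat_add d.2 d'.2]

variable (U : Type) [CommGroup U] (hU : ∀ u : U, (∀ N : ℕ+, ∃ g : U, g ^ (N : ℕ) = u) → u = 1)

/-- **The one-component model of Def. 3.1 / Prop. 3.2** (`Z_∞ = X`, smooth reduction, no cusps): `Fn = L^× = U × ϖ^ℤ`,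
`DIV = ℤ·[F]`, `DIV⁺ = ℤ_{≥0}·[F]`, `Div = DIV`, `Mero = const = Fn`, `divisor = ` valuation, `O_L^▷ = {v ≥ 0}`,
`Cusp = ∅`, `Comp = {F}`.  Every field of the interface is PROVED; `hU` = Prop. 3.2 (iii) for the unit group.
[cite: MochizukiEtTh2009, Def 3.1 p.70] -/
def oneComp : LogDivisorModel.{0} where
  Fn := U × Multiplicative ℤ
  DIV := Multiplicative ℤ
  DIVplus := OneComp.nonneg
  Div := ⊤
  exists_div_eq d := by
    rcases le_total 0 (Multiplicative.toAdd d) with h | h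
    · exact ⟨d, h, 1, le_refl (0 : ℤ), mul_one d⟩
    · refine ⟨1, le_refl (0 : ℤ), d⁻¹, ?_, mul_inv_cancel d⟩
      change 0 ≤ Multiplicative.toAdd d⁻¹
      rw [toAdd_inv]
      exact neg_nonneg.mpr h
  eq_one_of_mem_of_inv_mem d h h' := by
    change 0 ≤ Multiplicative.toAdd d at h
    change 0 ≤ Multiplicative.toAdd d⁻¹ at h'
    rw [toAdd_inv, neg_nonneg] at h'
    exact toAdd_eq_zero.mp (le_antisymm h' h)
  nonCuspidal := ⊤
  cuspidal := ⊥
  nonCuspidal_isCompl_cuspidal := isCompl_top_bot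
  logMero := ⊤
  divisor := (MonoidHom.snd U (Multiplicative ℤ)).comp (⊤ : Subgroup (U × Multiplicative ℤ)).subtype
  divisor_mem_Div _ := trivial
  const := ⊤
  const_le_logMero := le_rfl
  intConst := OneComp.nonneg.comap (MonoidHom.snd U (Multiplicative ℤ))
  intConst_le_const _ _ := trivial
  temperedMero := ⊤
  temperedMero_le_logMero := le_rfl
  exists_pow_mem_Div := ⟨1, fun _ => trivial⟩
  Cusp := PEmpty
  Comp := PUnit
  divPlusEquiv := OneComp.divPlusEquiv
  divPlusEquiv_nonCuspidal _ := ⟨fun _ c => c.elim, fun _ => trivial⟩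
  mem_intConst_of_divisor_mem _ h := h
  divisor_mem_of_mem_intConst _ h := ⟨h, trivial⟩
  divisor_eq_one_iff f := by
    change f.1.2 = 1 ↔ 0 ≤ Multiplicative.toAdd f.1.2 ∧ 0 ≤ Multiplicative.toAdd f.1⁻¹.2
    rw [Prod.snd_inv, toAdd_inv, neg_nonneg]
    constructor
    · intro h
      rw [h, toAdd_one]
      exact ⟨le_rfl, le_rfl⟩
    · rintro ⟨h, h'⟩
      exact toAdd_eq_zero.mp (le_antisymm h' h)
  eq_one_of_forall_exists_pow_eq f hf := by
    refine Prod.ext (hU f.1 fun N => ?_) ?_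
    · obtain ⟨g, hg⟩ := hf N
      exact ⟨g.1, by rw [← Prod.pow_fst, hg]⟩
    · -- the valuation of an infinitely divisible element is divisible by every `N`, hence `0`
      have hdvd : ∀ N : ℕ+, ((N : ℕ) : ℤ) ∣ Multiplicative.toAdd f.2 := fun N => by
        obtain ⟨g, hg⟩ := hf N
        refine ⟨Multiplicative.toAdd g.2, ?_⟩
        rw [← hg, Prod.pow_snd, toAdd_pow, nsmul_eq_mul]
      have h0 : Multiplicative.toAdd f.2 = 0 :=
        Int.eq_zero_of_dvd_of_natAbs_lt_natAbs (hdvd ⟨(Multiplicative.toAdd f.2).natAbs + 1, Nat.succ_pos _⟩)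
          (by rw [PNat.mk_coe, Int.natAbs_natCast]; exact Nat.lt_succ_self _)
      exact toAdd_eq_zero.mp h0

/-! ### Reading the fields -/

/-- The nonzero meromorphic functions of the model: `L^× = U × ϖ^ℤ`. [cite: MochizukiEtTh2009, Def 3.1 p.70] -/
theorem oneComp_Fn : (oneComp U hU).Fn = (U × Multiplicative ℤ) := rfl

/-- The log-divisors of the model: `ℤ·[F]`. [cite: MochizukiEtTh2009, Def 3.1 p.70] -/
theorem oneComp_DIV : (oneComp U hU).DIV = Multiplicative ℤ := rfl

/-- `DIV⁺ = ℤ_{≥0}·[F]`. [cite: MochizukiEtTh2009, Def 3.1 p.70] -/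
theorem oneComp_DIVplus : (oneComp U hU).DIVplus = OneComp.nonneg := rfl

/-- Every log-divisor is Cartier (`[F] = div(ϖ)`). [cite: MochizukiEtTh2009, Def 3.1 p.70] -/
theorem oneComp_Div : (oneComp U hU).Div = ⊤ := rfl

/-- `Div⁺ = Div ∩ DIV⁺ = ℤ_{≥0}·[F]`. [cite: MochizukiEtTh2009, Def 3.1 p.70] -/
theorem mem_oneComp_Divplus_iff (d : (oneComp U hU).DIV) :
    d ∈ (oneComp U hU).Divplus ↔ 0 ≤ OneComp.val d :=
  ⟨fun h => h.2, fun h => ⟨trivial, h⟩⟩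

/-- Every nonzero function of the model is log-meromorphic. [cite: MochizukiEtTh2009, Def 3.1 p.70] -/
theorem oneComp_logMero : (oneComp U hU).logMero = ⊤ := rfl

/-- Every log-meromorphic function of the model is constant (smooth reduction, no cusps; Prop. 3.2 (ii)).
[cite: MochizukiEtTh2009, Prop 3.2 p.70] -/
theorem oneComp_const : (oneComp U hU).const = ⊤ := rfl

/-- The divisor of zeroes and poles is the valuation: `div(u·ϖⁿ) = n·[F]`. [cite: MochizukiEtTh2009, Def 3.1 p.70] -/
@[simp] theorem oneComp_divisor_apply (f : (oneComp U hU).logMero) :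
    (oneComp U hU).divisor f = (f.1 : U × Multiplicative ℤ).2 := rfl

/-- The valuation coordinate of a divisor of the model. [cite: MochizukiEtTh2009, Def 3.1 p.70] -/
theorem oneComp_val_divisor (f : (oneComp U hU).logMero) :
    OneComp.val ((oneComp U hU).divisor f) = OneComp.val (f.1 : U × Multiplicative ℤ).2 := rfl

/-- `O_L^▷ = {v ≥ 0}`. [cite: MochizukiEtTh2009, Prop 3.2 p.70] -/
theorem mem_oneComp_intConst_iff (f : (oneComp U hU).Fn) :
    f ∈ (oneComp U hU).intConst ↔ 0 ≤ OneComp.val (f : U × Multiplicative ℤ).2 := Iff.rfl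

/-- No cusps. [cite: MochizukiEtTh2009, Def 3.1 p.70] -/
theorem oneComp_Cusp : (oneComp U hU).Cusp = PEmpty := rfl

/-- One irreducible component of the special fibre. [cite: MochizukiEtTh2009, Def 3.1 p.70] -/
theorem oneComp_Comp : (oneComp U hU).Comp = PUnit := rfl

/-- The multiplicity of an effective log-divisor along the component `F` is its (non-negative) valuation.
[cite: MochizukiEtTh2009, Def 3.1 p.70] -/
theorem oneComp_mult_inr (d : (oneComp U hU).DIVplus) (c : PUnit) :
    (oneComp U hU).mult d (Sum.inr c) = Int.toNat (OneComp.val d.1) := by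
  change Multiplicative.toAdd (OneComp.divPlusEquiv d (Sum.inr c)) = _
  rfl

/-- **abc-iut-w6-d058's tacit Def. 3.1 (i) compatibilities `CuspLaws` HOLD** in the one-component model: the (trivial)
cuspidal log-divisors are Cartier, and an effective log-divisor is cuspidal (`= 0`) iff its multiplicity along `F`
vanishes. [cite: MochizukiEtTh2009, Def 3.1 p.70] -/
theorem cuspLaws_oneComp : (oneComp U hU).CuspLaws where
  cuspidal_le_Div := bot_le
  mem_cuspidal_iff d := by
    have hd : 0 ≤ OneComp.val d.1 := d.2
    constructor
    · intro h c
      have h1 : d.1 = 1 := h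
      rw [oneComp_mult_inr, h1]
      rfl
    · intro h
      have h0 := h PUnit.unit
      rw [oneComp_mult_inr, Int.toNat_eq_zero] at h0
      exact (OneComp.val_eq_zero_iff _).mp (le_antisymm h0 hd)

/-! ### The unconditional instance `U = 1` (value-group shadow `L^×/O_L^×`) and non-vacuity -/

/-- **The value-group model** `oneComp₁ := oneComp 1`: `Fn = ϖ^ℤ`, no hypothesis at all.
[cite: MochizukiEtTh2009, Def 3.1 p.70] -/
def oneComp₁ : LogDivisorModel.{0} := oneComp PUnit fun _ _ => Subsingleton.elim _ _

/-- Its cusp laws. [cite: MochizukiEtTh2009, Def 3.1 p.70] -/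
theorem cuspLaws_oneComp₁ : oneComp₁.CuspLaws := cuspLaws_oneComp PUnit _

/-- **Non-degeneracy**: the one-component models have a NON-TRIVIAL effective Cartier log-divisor `[F]` — contrast
`LogDivisorModel.toy` (`DIV = 1`). [cite: MochizukiEtTh2009, Def 3.1 p.70] -/
theorem exists_ne_one_mem_Divplus_oneComp : ∃ d : (oneComp U hU).DIV, d ≠ 1 ∧ d ∈ (oneComp U hU).Divplus :=
  ⟨Multiplicative.ofAdd (1 : ℤ), fun h => one_ne_zero (ofAdd_eq_one.mp h), trivial, by
    change 0 ≤ Multiplicative.toAdd (Multiplicative.ofAdd (1 : ℤ)); rw [toAdd_ofAdd]; exact zero_le_one⟩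

/-- The interface `LogDivisorModel` has a non-degenerate inhabitant. [cite: MochizukiEtTh2009, Def 3.1 p.70] -/
theorem nonempty_nondegenerate :
    ∃ Z : LogDivisorModel.{0}, ∃ d : Z.DIV, d ≠ 1 ∧ d ∈ Z.Divplus :=
  ⟨oneComp₁, exists_ne_one_mem_Divplus_oneComp PUnit _⟩

end LogDivisorModel

end Literature.AnabelianGeometry.EtaleTheta
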